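import Summits.AtomisticToContinuum.BoseEinsteinCondensation.Theses.BECStronglyRayleigh
import Summits.AtomisticToContinuum.BoseEinsteinCondensation.Theses.BECLiebAntibunching
import Summits.AtomisticToContinuum.BoseEinsteinCondensation.Theses.BECCountConvexity
import Literature.MathematicalPhysics.QuantumManyBody.BoseGasThermodynamicLimitRuelle
import Literature.MathematicalPhysics.QuantumManyBody.CondensateOccupationStability
import Literature.Barriers.AtomisticToContinuum.KineticGapLengthScalesThermodynamicWindow
import Summits.AtomisticToContinuum.BoseEinsteinCondensation.Theorems.LatticeToPeriodicBridge.Negative.WindowedBridge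
-- READ, not importable at check time (landed 2026-08-16T03:26–03:27Z, not yet built on the farm: `remote:stale:unbuilt`):
-- import Summits.AtomisticToContinuum.BoseEinsteinCondensation.Theorems.LatticeToPeriodicBridge.Negative.UniformThreshold
-- import Summits.AtomisticToContinuum.BoseEinsteinCondensation.Theorems.LatticeToPeriodicBridge.Negative.TwoBodyWitness

/-!
# Line `coarse-cell-lorentzian` — skeleton for crux `LatticeToPeriodicBridge` (stmt-AtomisticToContinuum-9674)

Route `route-AtomisticToContinuum-BECStronglyRayleigh` (rank-4 crux, shared by no other route); crux decl
`Summit.AtomisticToContinuum.BoseEinsteinCondensation.Theses.BECStronglyRayleigh.LatticeToPeriodicBridge`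
(`KineticLatticeBEC → PeriodicBEC-body`), concluded BY NAME by `LatticeToPeriodicBridge_of` below from the six
registered stubs (`Sig.stub_*` = the statement, `theorem stub_* : Sig.stub_* := by sorry` = the registered
obligation; `latticeToPeriodicBridge_skeleton` applies the composition to the six sorried stubs). Planner
crux-plan v1 (2026-08-16, written against `Disproof.lean` gen 2, 1539 lines, and the three landed Negative files —
`WindowedBridge` imported, `UniformThreshold` / `TwoBodyWitness` read but not yet built on the farm at check time). Line card: `Lines/coarse-cell-lorentzian.md`.

## The line (idea card `Ideas/coarse-cell-lorentzian.md`, TRIAGE-r1-1/2/3: pass ×3)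

THEOREM S ONE SCALE UP, PAIR-COARSE FORM. Cut the thermodynamic torus of side `L = L_N = (N/ρ)^{1/3}` into
`M³` cubic cells of side `b = L/M ∈ [b_*, 2b_*]` (`M = ⌊L/b_*⌋`, `b_* = b_*(v)` a fixed microscopic scale
`≳ max(a, R₀)`). For a real non-negative near-minimiser `Ψ` of the periodic `N = N'+2`-body energy and a
background `X' ∈ cell^{N'}` of `N'` particles at FIXED CONTINUUM POSITIONS put

* `K_{X'}(x,y) = ∫_{ξ∈C_x}∫_{η∈C_y} Ψ(ξ,η,X') dξ dη` — the conditional CELL-PAIR KERNEL (`cellKernel`),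
* `r_{X'}(x) = Σ_y K_{X'}(x,y)` — the cell pair-insertion field (`cellField`), `R_{X'} = Σ_x r_{X'}(x)`,
* `I_K = ∫dX' ‖K_{X'}‖_F²` (`kernelMass`), `I_F = ∫dX' [Σ_x r³/R + ‖r‖⁴/R²]` (`fieldMoment`),
  `I_r = ∫dX' ‖r_{X'}‖²` (`fieldMass`).

Only the PAIR is coarse-grained; the background stays fine. Four inequalities and one transfer:

1. `stub_cellNormRetention` (M/L; Poincaré–Wirtinger on one cube, twice): `b⁶(1 − 2b²⟨H⟩_Ψ/N) ≤ I_K`.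
2. `stub_integratedPairCoherence` (THE LEVER; open, decided at `N = 2`): `I_K ≤ 2·I_F` for real non-negative
   `δ`-near-minimisers at cell scale `b ≥ b₀(v)` and density `≤ ρ_c(v)` — the integrated, factor-2 (robust)
   form of "every conditional cell-pair kernel has Lorentz signature" (rank-one dominance,
   `StableImpliesPairCoherence`'s proof one scale up).
3. `stub_cellInsertionDelocalisation` (HARDEST; rank 3's twin one scale up): `M³·I_F ≤ 𝕄·I_r`.
4. `stub_cellPairSumRule` (M; the flat-cell dictionary, `PairKernelSumRule` as an inequality):
   `N·M⁻³b⁻⁶·I_r ≤ condensateOccupation`.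
5. `stub_diluteEnergyCeiling` (M; LSSY Thm 2.2 — proved in the tree — plus `a ≤ R₀ < ∞`): `E₀^per ≤ C(v)ρN`
   eventually, feeding the retention factor of 1. with `δ ≤ 1`: retention `≥ ½` once `ρ ≤ 1/(32b_*²(C+1))`,
   `N ≥ 32 b_*²`.
6. `stub_positiveTransfer` (M, = PeriodicRigidity (stmt-9467) + PeriodicOccupationStability (stmt-9164) +
   existence of positive near-minimisers): a condensate bound for all REAL NON-NEGATIVE `δ₁`-near-minimisers
   passes to ALL `δ`-near-minimisers at a quarter of the constant.

Chain (proved here, `periodicBEC_of`): `b⁶/2 ≤ I_K ≤ 2I_F ≤ 2𝕄I_r/M³` ⇒ `n₀ ≥ N·M⁻³b⁻⁶I_r ≥ N/(4𝕄)` for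
real non-negative `δ₁`-near-minimisers (`δ₁ = min(δ₄, δ₅, 1)`) ⇒ `n₀ ≥ N/(16𝕄)` for all `δ`-near-minimisers,
for every repulsive finite-range `v` and `ρ < ρ₀(v) = min(ρ₁, ρ_c, ρ_d, ρ_r, 1/(32b_*²(C+1)))`, i.e. the
consequent of the crux; `LatticeToPeriodicBridge_of` discards the antecedent (`Disproof.crux_of_periodicBEC`
shape, stated openly by the card and accepted by the panel: the lattice MECHANISM — ranks 2 + 3 — is
re-instantiated at scale `b ≈ 3a`, the lattice THEOREM is not consumed).

## Disproof.lean (gen 2) honoured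

* §1 `crux_of_periodicBEC` / `crux_iff_without_of_kinetic`: this line is of that shape (proves `B`).
* §2: no `_false_without_` theorem exists for this crux (single hypothesis `A`, dropping it leaves stmt-0826).
* §4 (landed `Negative/WindowedBridge.lean`): no window certificate is produced — every slack is existential and
  chosen AFTER `(N, L, M)` inside stubs 2/3/6; energy enters only through the retention factor of stub 1 (valid in
  any `O(ρN)` window and harmless there), never as a condensation certificate.
* §7 (landed `Negative/UniformThreshold.lean`, `not_uniformConsequent`): `ρ₀` depends on `v` through
  `C(v) ∝ a`, `b₀(v)`, `b₁(v)`, `ρ_c(v)`, `ρ_d(v)`, `ρ_r(v)`; no `∃ρ₀ ∀v`.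
* §8a (`not_cardTwoBodyCellLorentzian`; landed `Negative/TwoBodyWitness.lean`): the refuted statement is the
  NEAR-MINIMISER STRICT-SIGNATURE form; the lever registered here is the INTEGRATED FACTOR-2 form, which the §8a
  witnesses satisfy with room (`K = k(b⁶𝟙𝟙ᵀ + εE₀₀)` on 8 cells: `I_K ≈ 64k²b¹²`, `2I_F ≈ 256k²b¹²`; the
  `sin ⊗ sin` witness has `r ∝ 𝟙`, `I_K = c²(M⁶b¹² + o(1)) ≤ 4c²M⁶b¹²`) — so `0 < scatteringLength v` is NOT a
  hypothesis of any stub (it would force an `a = 0 ⇒ v = 0 a.e.` side-lemma into the composition); positivity of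
  `a` re-enters only inside the lever's PROOF (strict signature margin `≍ ab⁵` of the exact kernels), where the
  slack `δ(v, L, M, N')` is existential, exactly as §8a's LESSON prescribes ("robustness must come from the
  factor-2 slack of the integrated inequality, not from openness of signature").
* §8a remark "`IntegratedPairCoherence` is not universal (`K = I₃`)": with factor 2 the forbidden kernels are the
  paired-in-cell / `≥ 5`-fragment ones (`K = I_n`, `n ≥ 5`; `K = ⊕₅ J`), which is the lever's content.
-/

noncomputable section

open MeasureTheory Filter
open scoped ENNReal Topology

namespace Summit.AtomisticToContinuum.BoseEinsteinCondensation.Cruxes.LatticeToPeriodicBridge.CoarseCellLorentzian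

open Literature.MathematicalPhysics.QuantumManyBody.BoseGas
open Literature.Barriers.AtomisticToContinuum.BoseGas
open Summit.AtomisticToContinuum.BoseEinsteinCondensation.Theses
open Summit.AtomisticToContinuum.BoseEinsteinCondensation.Theses.BECStronglyRayleigh

/-! ## Vocabulary (data: sets and real numbers; no `Prop` is hidden in a definition) -/

/-- The cubic cell `∏_k [x_k b, (x_k+1) b)` of side `b` with integer corner `x ∈ (Fin M)³`; for `b = L/M` the
`M³` cells tile the fundamental cell `[0,L)³` of the torus exactly. -/
def torusCell (M : ℕ) (b : ℝ) (x : Fin 3 → Fin M) : Set Space :=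
  {ξ | ∀ k, ξ k ∈ Set.Ico (((x k : ℕ) : ℝ) * b) ((((x k : ℕ) : ℝ) + 1) * b)}

/-- The configuration `(ξ, η, X')` of `N' + 2` particles: tagged pair `(ξ, η)` in slots `0, 1`, background `X'`. -/
def pairConfig {N' : ℕ} (ξ η : Space) (X' : Config N') : Config (N' + 2) :=
  Fin.cons ξ (Fin.cons η X')

/-- **Conditional cell-pair kernel** `K_{X'}(x,y) = ∫_{ξ ∈ C_x} ∫_{η ∈ C_y} Re Ψ(ξ, η, X') dη dξ` of an
`(N'+2)`-body wave function on the torus of side `L` cut into `M³` cells of side `L/M`, at background `X'`. -/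
def cellKernel {N' : ℕ} (L : ℝ) (M : ℕ) (Ψ : Config (N' + 2) → ℂ) (X' : Config N')
    (x y : Fin 3 → Fin M) : ℝ :=
  ∫ ξ in torusCell M (L / M) x, ∫ η in torusCell M (L / M) y, (Ψ (pairConfig ξ η X')).re

/-- **Cell pair-insertion field** `r_{X'}(x) = Σ_y K_{X'}(x,y)`. -/
def cellField {N' : ℕ} (L : ℝ) (M : ℕ) (Ψ : Config (N' + 2) → ℂ) (X' : Config N')
    (x : Fin 3 → Fin M) : ℝ :=
  ∑ y, cellKernel L M Ψ X' x y

/-- `I_K = ∫_{cell^{N'}} ‖K_{X'}‖_F² dX'` (background-integrated Frobenius mass of the kernels). -/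
def kernelMass {N' : ℕ} (L : ℝ) (M : ℕ) (Ψ : Config (N' + 2) → ℂ) : ℝ :=
  ∫ X' in cellN N' L, ∑ x, ∑ y, cellKernel L M Ψ X' x y ^ 2

/-- `I_F = ∫_{cell^{N'}} [Σ_x r_{X'}(x)³ / R_{X'} + ‖r_{X'}‖⁴ / R_{X'}²] dX'` (the rank-one-dominance majorant;
Lean's `x / 0 = 0` matches `K_{X'} = 0`). -/
def fieldMoment {N' : ℕ} (L : ℝ) (M : ℕ) (Ψ : Config (N' + 2) → ℂ) : ℝ :=
  ∫ X' in cellN N' L,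
    ((∑ x, cellField L M Ψ X' x ^ 3) / (∑ x, cellField L M Ψ X' x) +
      (∑ x, cellField L M Ψ X' x ^ 2) ^ 2 / (∑ x, cellField L M Ψ X' x) ^ 2)

/-- `I_r = ∫_{cell^{N'}} ‖r_{X'}‖² dX'`. -/
def fieldMass {N' : ℕ} (L : ℝ) (M : ℕ) (Ψ : Config (N' + 2) → ℂ) : ℝ :=
  ∫ X' in cellN N' L, ∑ x, cellField L M Ψ X' x ^ 2

/-- The consequent of the crux at one potential (verbatim the body of stmt-0826 / `Negative.ConsequentAt`). -/
def PeriodicBECAt (v : ℝ → ℝ≥0∞) : Prop :=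
  ∃ ρ₀ : ℝ, 0 < ρ₀ ∧ ∀ ρ : ℝ, 0 < ρ → ρ < ρ₀ → ∃ c : ℝ, 0 < c ∧ ∀ᶠ N : ℕ in atTop,
    ∃ δ : ℝ≥0∞, 0 < δ ∧ ∀ Ψ : PeriodicTrialState N (sideLength ρ N),
      periodicEnergy v Ψ ≤ periodicGroundStateEnergy v N (sideLength ρ N) + δ →
        ENNReal.ofReal (c * N) ≤ condensateOccupation N (sideLength ρ N) Ψ.ψ

/-- The crux restated with this vocabulary — DEFINITIONALLY. -/
theorem crux_iff :
    LatticeToPeriodicBridge ↔ (KineticLatticeBEC → ∀ v, IsRepulsiveFiniteRange v → PeriodicBECAt v) :=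
  Iff.rfl

/-- … and it is the landed `Negative.ConsequentAt` (so §1/§4/§7 of the Disproof speak about these stubs). -/
theorem periodicBECAt_iff (v : ℝ → ℝ≥0∞) :
    PeriodicBECAt v ↔ Theorems.LatticeToPeriodicBridge.Negative.ConsequentAt v :=
  Iff.rfl

/-! ## The six statements of the line (`Sig.stub_<name>` = the registered signature) -/

/-- **S1 — dilute energy ceiling** (size M). For every repulsive finite-range `v` there are `C ≥ 0` and
`ρ₁ > 0` such that for `0 < ρ < ρ₁`, eventually in `N`, `E₀^per(N, L_N) ≤ C ρ N` (`L_N = (N/ρ)^{1/3}`).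
Proof route: `a = scatteringLength v < ∞` (`scatteringLength_ne_top_of_finiteRange`, hard cores included),
`LSSY2005_upperBound_periodic_holds` (PROVED: `E₀ ≤ 4πρ₁'a(1 + C'a/b_ρ)N`, `ρ₁' = (N−1)/L³ ≤ ρ`,
`b_ρ = (4πρ₁'/3)^{-1/3}`) with `a/b_ρ ≤ a(4πρ/3)^{1/3} ≤ c'` for `ρ < 3c'³/(4πa³)` (any `ρ` if `a = 0`),
`2R₀ < L_N` and `N ≥ 2` eventually; `C = 4πa(1 + C'c')`. The only place energy enters the line.
[LSSY2005 Thm 2.2 (2.14); App. C Remark 2] -/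
def Sig.stub_diluteEnergyCeiling : Prop :=
  ∀ v : ℝ → ℝ≥0∞, IsRepulsiveFiniteRange v → ∃ C : ℝ, 0 ≤ C ∧ ∃ ρ₁ : ℝ, 0 < ρ₁ ∧
    ∀ ρ : ℝ, 0 < ρ → ρ < ρ₁ → ∀ᶠ N : ℕ in atTop,
      periodicGroundStateEnergy v N (sideLength ρ N) ≤ ENNReal.ofReal (C * ρ * N)

/-- **S2 — cell norm retention** (size M/L: Poincaré–Wirtinger on a cube is not in Mathlib). For a REAL-valued
periodic trial state `Ψ` of `N'+2` bosons with finite energy and `M ≥ 1` cells per side (`b = L/M`):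
`b⁶ (1 − 2b²·E(Ψ)/(N'+2)) ≤ I_K`. Proof route: `Σ_{x,y}K_{X'}(x,y)² = b⁶‖(P⊗P)Ψ(·,·,X')‖²` with `P` the
cell-averaging projection of `L²(cell)`; `1 − P⊗P ≤ (1−P)⊗1 + 1⊗(1−P)`; Poincaré–Wirtinger on each cube
`‖f − f̄_C‖²_{L²(C)} ≤ b²‖∇f‖²_{L²(C)}` (any constant `≤ 1` in front of `b²` will do — the sharp Neumann one is
`π⁻²`); the kinetic energy of particles `0` and `1` is `2T/(N'+2)` by Bose symmetry and `T ≤ periodicEnergy`;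
`‖Ψ‖²_{L²(cell^N)} = 1`, `Re Ψ = Ψ`. Any potential `v` (the interaction is only dropped). [folklore;
PayneWeinberger1960 for the convex-domain constant] -/
def Sig.stub_cellNormRetention : Prop :=
  ∀ (v : ℝ → ℝ≥0∞) (N' : ℕ) (L : ℝ) (M : ℕ), 0 < L → 1 ≤ M →
    ∀ Ψ : PeriodicTrialState (N' + 2) L, (∀ X, (Ψ.ψ X).im = 0) → periodicEnergy v Ψ ≠ ⊤ →
      (L / M) ^ 6 * (1 - 2 * (L / M) ^ 2 * (periodicEnergy v Ψ).toReal / ((N' : ℝ) + 2)) ≤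
        kernelMass L M Ψ.ψ

/-- **S3 — cell pair sum rule, "≥" direction** (size M; the flat-cell dictionary). For every periodic trial
state of `N'+2` bosons and `M ≥ 1`: `(N'+2)·M⁻³·b⁻⁶·I_r ≤ condensateOccupation` (as `ENNReal.ofReal _ ≤ _`).
Proof route: `condensateOccupation = (N'+2) L⁻³ ∫_{cell^{N'+1}} |∫_cell Ψ(ξ, Y) dξ|² dY` (unfold `occupation`,
`constantMode`, the `cellN` indicator; `Matrix.vecCons = Fin.cons`); `|z|² ≥ (Re z)²`; write `Y = (η, X')` and
split `∫_cell dη = Σ_y ∫_{C_y}`; Cauchy–Schwarz on each `C_y`: `∫_{C_y} g² ≥ b⁻³(∫_{C_y} g)²` with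
`g(η) = ∫_cell Re Ψ(ξ,η,X')dξ`, `∫_{C_y} g = Σ_x K_{X'}(x,y)` (Fubini); Bose symmetry in slots `0,1` gives
`K_{X'}(x,y) = K_{X'}(y,x)`, so column sums are `r_{X'}(y)`; `L⁻³b⁻³ = M⁻³b⁻⁶`. No reality / positivity /
near-minimiser hypothesis. [PenroseOnsager1956; Fournais2020 (1.3)–(1.5)] -/
def Sig.stub_cellPairSumRule : Prop :=
  ∀ (N' : ℕ) (L : ℝ) (M : ℕ), 0 < L → 1 ≤ M → ∀ Ψ : PeriodicTrialState (N' + 2) L,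
    ENNReal.ofReal (((N' : ℝ) + 2) * ((M : ℝ) ^ 3)⁻¹ * ((L / M) ^ 6)⁻¹ * fieldMass L M Ψ.ψ) ≤
      condensateOccupation (N' + 2) L Ψ.ψ

/-- **S4 — integrated pair coherence, THE LEVER** (open; "Theorem S one scale up", robust integrated form).
For every repulsive finite-range `v` there are a cell scale `b₀ = b₀(v) > 0` (`≍ max(a, R₀)`; hard spheres:
signature of the `N = 2` kernel holds iff `b/a ≳ 1.72`, three independent computations of the panel) and a density
`ρ_c(v) > 0` such that on every torus of side `L` cut into `M ≥ 2` cells per side of side `b = L/M ≥ b₀`, for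
every particle number `N'+2 ≤ ρ_c L³`, some slack `δ > 0` makes every REAL NON-NEGATIVE `δ`-near-minimiser
satisfy `I_K ≤ 2·I_F`. Mechanism: for the exact ground state `Ψ₀` and a.e. background `X'`, the entrywise
non-negative symmetric kernel `K_{X'}` has exactly ONE positive eigenvalue (Lorentz signature) ⟺ reverse
Cauchy–Schwarz `(𝟙ᵀKu)² ≥ (𝟙ᵀK𝟙)(uᵀKu)`; `u = e_x + e_y` and `u = r` give `K(x,y) ≤ (r_x+r_y)²/(2R)`,
`rᵀKr ≤ ‖r‖⁴/R`, whence `‖K‖_F² ≤ Σr³/R + ‖r‖⁴/R²` pointwise in `X'` (the route's proof of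
`StableImpliesPairCoherence`, continuum diagonal included); integrate; the factor 2 is the robustness margin that
carries the inequality from `Ψ₀` to `C¹` near-minimisers (both sides are `L²`-continuous on real non-negative
states, `I_F(Ψ₀) > 0`; rigidity = stub S6's engine), so NO openness of signature and NO `0 < a(v)` is needed in
the statement (Disproof §8a: at `a = 0` the flat kernel has `I_K = I_F/2`). Why signature: `N = 2` —
`K = b⁶(f_∞𝟙𝟙ᵀ − W̄)`, `ŵ(k) = 4πa(k)/k²`, aliases `O((a/b)³)`; Jastrow level, any `N`, any background —
`K = f_∞UUᵀ − W_F`, `W_F(x,y) = ∫_{C_x}∫_{C_y}F w F` PSD whenever the cell-averaged `w` is (28/28 frozen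
backgrounds, TRIAGE-r1-1 gen 2); lattice twins block-Lorentzian on `4³`, `6³` (TRIAGE-r1-3); beyond Jastrow
(three-body correlations at `O((a/b)²)`) CONJECTURAL — no engine yet (bondwise Borcea–Brändén dies off-bond).
Forbids: paired-in-cell kernels (`K = I_n`, `n ≥ 5`) and `≥ 5` macroscopic fragments (`K = ⊕₅J`).
[BrandenHuh2019 Prop 1.2 / Lemma 1.5; BorceaBrandenLiggett2007; LSSY2005 App. C; Fournais2020 (A.5)] -/
def Sig.stub_integratedPairCoherence : Prop :=
  ∀ v : ℝ → ℝ≥0∞, IsRepulsiveFiniteRange v → ∃ b₀ : ℝ, 0 < b₀ ∧ ∃ ρc : ℝ, 0 < ρc ∧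
    ∀ (L : ℝ) (M : ℕ), 0 < L → 2 ≤ M → b₀ ≤ L / M →
      ∀ N' : ℕ, ((N' : ℝ) + 2) ≤ ρc * L ^ 3 →
        ∃ δ : ℝ≥0∞, 0 < δ ∧ ∀ Ψ : PeriodicTrialState (N' + 2) L,
          (∀ X, 0 ≤ (Ψ.ψ X).re ∧ (Ψ.ψ X).im = 0) →
          periodicEnergy v Ψ ≤ periodicGroundStateEnergy v (N' + 2) L + δ →
            kernelMass L M Ψ.ψ ≤ 2 * fieldMoment L M Ψ.ψ

/-- **S5 — cell insertion delocalisation, HARDEST** (rank 3 `InsertionFieldDelocalisation` one scale up, with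
the background in continuum configuration space; XL, plausibly as hard as the conjunct). For every repulsive
finite-range `v` there are `𝕄 = 𝕄(v) > 0`, a cell scale `b₁(v) > 0` and a density `ρ_d(v) > 0` such that on
every torus cut into `M ≥ 2` cells per side of side `b = L/M ≥ b₁`, for `N'+2 ≤ ρ_d L³`, some `δ > 0` makes every
real non-negative `δ`-near-minimiser satisfy `M³·I_F ≤ 𝕄·I_r`, i.e. the `ω`-average (`ω_{X'} ∝ ‖r_{X'}‖²`) of
`M³Φ_{X'}`, `Φ = Σr³/(R‖r‖²) + ‖r‖²/R²`, is `≤ 𝕄`. Flat field: `M³Φ = 2` (so `𝕄 ≥ 2`; `v = 0`: `𝕄 = 4` with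
the near-minimiser margin); for `r = r̄(1+ε)`, `M³Φ ≈ 2 + 3⟨ε²⟩`: the statement is a bound on the mean-square
RELATIVE fluctuation across cells of the two-particle insertion field `r_{X'} =` cell sums of
`χ_{X'}(ξ) = ∫Ψ(ξ,η,X')dη` — off-diagonal long-range order of the pair-insertion amplitude in all but name
(infrared-finite in `d = 3` at Bogoliubov level, `Σ_k 1/(Nk) < ∞`; divergent in `d = 1, 2`). Trivially true at
fixed `M` with `𝕄 = 2M³` (`F(r) ≤ 2‖r‖²` for `r ≥ 0`); the content is uniformity as `M = L_N/b → ∞`. Small `N`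
at large `L` is harmless (`N' = 0`: `r` exactly flat by translation invariance). Same family as
`BECRieszReverseHolder.CoarseGrainedReverseHolder` at resolution `ℓ = b` (may borrow its Riesz-shadow engine).
[ReattoChester1967; LSSY2005 Ch. 5; BorceaBrandenLiggett2007 Thm 4.9 (negative association, lattice twin)] -/
def Sig.stub_cellInsertionDelocalisation : Prop :=
  ∀ v : ℝ → ℝ≥0∞, IsRepulsiveFiniteRange v → ∃ 𝕄 : ℝ, 0 < 𝕄 ∧ ∃ b₁ : ℝ, 0 < b₁ ∧ ∃ ρd : ℝ, 0 < ρd ∧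
    ∀ (L : ℝ) (M : ℕ), 0 < L → 2 ≤ M → b₁ ≤ L / M →
      ∀ N' : ℕ, ((N' : ℝ) + 2) ≤ ρd * L ^ 3 →
        ∃ δ : ℝ≥0∞, 0 < δ ∧ ∀ Ψ : PeriodicTrialState (N' + 2) L,
          (∀ X, 0 ≤ (Ψ.ψ X).re ∧ (Ψ.ψ X).im = 0) →
          periodicEnergy v Ψ ≤ periodicGroundStateEnergy v (N' + 2) L + δ →
            (M : ℝ) ^ 3 * fieldMoment L M Ψ.ψ ≤ 𝕄 * fieldMass L M Ψ.ψ

/-- **S6 — positive transfer** (size M; fixed volume; RESHAPED by the lead 2026-08-16: the two fixed-`N` inputs that are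
route items elsewhere in the sub-problem — `PeriodicRigidity` (stmt-AtomisticToContinuum-9467, taken in its weakest typed
form `∀η ∀ᶠN ∃δ`, namespace `BECLiebAntibunching`) and `PositivePeriodicNearMinimiser` (stmt-AtomisticToContinuum-14006,
namespace `BECCountConvexity`) — are taken BY NAME as antecedents, exactly as line `muffin-tin` takes 9677/9678; the
occupation-stability input (stmt-9164) is NOT taken: it is the Literature theorem
`PeriodicTrialState.condensateOccupation_le_add_of_phase_sq_dist_le`). For every repulsive finite-range `v` there is `ρ_r > 0`
such that for `0 < ρ < ρ_r` and every level `c₁ > 0`, eventually in `N`: if for some slack `δ₁ > 0` EVERY real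
non-negative `δ₁`-near-minimiser on the torus of side `L_N` has `n₀ ≥ c₁N`, then for some `δ > 0` EVERY
`δ`-near-minimiser has `n₀ ≥ (c₁/4)N`. Proof route (the BECRieszShadow frame, items shared by 14 routes): take
`ρ_r ≤` the thresholds of `PeriodicRigidity` (stmt-9467: any two `δ_R`-near-minimisers are `η`-close in
`L²(cell^N)` up to a unit phase, `η := c₁/16` fixed before `N`) and of
`exists_eventually_periodicGroundStateEnergy_lt_top` (so `E₀^per < ∞`); `δ := min(δ₁, δ_R)/4`; given a
`δ`-near-minimiser `Φ`, the state `(√(|Φ|²+ε²) − ε)/‖·‖` is a `C¹`, periodic, symmetric, REAL NON-NEGATIVE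
`2δ`-near-minimiser `Ψ` (diamagnetic inequality `|∇√(|Φ|²+ε²)| ≤ |∇Φ|`, `√(|Φ|²+ε²) − ε ≤ |Φ|`, `‖·‖ → 1`),
hence `n₀(Ψ) ≥ c₁N`; `PeriodicOccupationStability` (stmt-9164: `√n₀(Φ) ≥ √n₀(Ψ) − √(Nη)`) gives
`n₀(Φ) ≥ (9/16)c₁N`. Why it might fail: only through `PeriodicRigidity` (hard-core walls disconnecting the
fixed-`N` configuration space; caged components must lie a gap above `E₀^per` — excluded at low density).
[ReedSimonIV1978 XIII.12/47; BaryshnikovBubenikKahle2013; LSSY2005 §1.2] -/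
def Sig.stub_positiveTransfer : Prop :=
  BECLiebAntibunching.PeriodicRigidity → BECCountConvexity.PositivePeriodicNearMinimiser →
  ∀ v : ℝ → ℝ≥0∞, IsRepulsiveFiniteRange v → ∃ ρr : ℝ, 0 < ρr ∧ ∀ ρ : ℝ, 0 < ρ → ρ < ρr →
    ∀ c₁ : ℝ, 0 < c₁ → ∀ᶠ N : ℕ in atTop, ∀ δ₁ : ℝ≥0∞, 0 < δ₁ →
      (∀ Ψ : PeriodicTrialState N (sideLength ρ N), (∀ X, 0 ≤ (Ψ.ψ X).re ∧ (Ψ.ψ X).im = 0) →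
        periodicEnergy v Ψ ≤ periodicGroundStateEnergy v N (sideLength ρ N) + δ₁ →
          ENNReal.ofReal (c₁ * N) ≤ condensateOccupation N (sideLength ρ N) Ψ.ψ) →
      ∃ δ : ℝ≥0∞, 0 < δ ∧ ∀ Ψ : PeriodicTrialState N (sideLength ρ N),
        periodicEnergy v Ψ ≤ periodicGroundStateEnergy v N (sideLength ρ N) + δ →
          ENNReal.ofReal (c₁ / 4 * N) ≤ condensateOccupation N (sideLength ρ N) Ψ.ψ

/-! ## The six registered stubs -/

/-- Registered stub S1 (dilute energy ceiling; M). -/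
theorem stub_diluteEnergyCeiling : Sig.stub_diluteEnergyCeiling := by
  sorry

/-- Registered stub S2 (cell norm retention; M/L). -/
theorem stub_cellNormRetention : Sig.stub_cellNormRetention := by
  sorry

/-- Registered stub S3 (cell pair sum rule; M). -/
theorem stub_cellPairSumRule : Sig.stub_cellPairSumRule := by
  sorry

/-- Registered stub S4 (integrated pair coherence — the lever; open). -/
theorem stub_integratedPairCoherence : Sig.stub_integratedPairCoherence := by
  sorry

/-- Registered stub S5 (cell insertion delocalisation — hardest; XL/open). -/
theorem stub_cellInsertionDelocalisation : Sig.stub_cellInsertionDelocalisation := by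
  sorry

/-- Registered stub S6 (positive transfer; M, shared rigidity frame). -/
theorem stub_positiveTransfer : Sig.stub_positiveTransfer := by
  sorry

/-! ## Composition (sorry-free) -/

set_option maxHeartbeats 400000 in
/-- **The coarse-cell assembly**: the six statements give the consequent of the crux for EVERY repulsive
finite-range `v`, with `ρ₀ = min(ρ₁, ρ_c, ρ_d, ρ_r, 1/(32b_*²(C+1)))`, `b_* = max(b₀, b₁)`, `M = ⌊L_N/b_*⌋`
(so `b = L_N/M ∈ [b_*, 2b_*]`), `δ₁ = min(δ₄, δ₅, 1)`, `c = 1/(16𝕄)`. Real arithmetic: retention `≥ ½`, then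
`b⁶/2 ≤ I_K ≤ 2I_F ≤ 2𝕄I_r/M³`, so `N·M⁻³b⁻⁶I_r ≥ N/(4𝕄)`; S3 turns this into `n₀ ≥ N/(4𝕄)` for real
non-negative `δ₁`-near-minimisers and S6 into `n₀ ≥ N/(16𝕄)` for all `δ`-near-minimisers. -/
theorem periodicBEC_of (h1 : Sig.stub_diluteEnergyCeiling) (h2 : Sig.stub_cellNormRetention)
    (h3 : Sig.stub_cellPairSumRule) (h4 : Sig.stub_integratedPairCoherence)
    (h5 : Sig.stub_cellInsertionDelocalisation) (h6 : Sig.stub_positiveTransfer)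
    (hR : BECLiebAntibunching.PeriodicRigidity) (hP : BECCountConvexity.PositivePeriodicNearMinimiser)
    (v : ℝ → ℝ≥0∞) (hv : IsRepulsiveFiniteRange v) : PeriodicBECAt v := by
  -- constants of the line
  obtain ⟨C_E, hC_E, ρ₁, hρ₁, hE⟩ := h1 v hv
  obtain ⟨b₀, hb₀, ρc, hρc, hcoh⟩ := h4 v hv
  obtain ⟨𝕄, h𝕄, b₁, hb₁, ρd, hρd, hdel⟩ := h5 v hv
  obtain ⟨ρr, hρr, htr⟩ := h6 hR hP v hv
  set bs : ℝ := max b₀ b₁ with hbs_def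
  have hbs : 0 < bs := lt_max_of_lt_left hb₀
  have hbs0 : bs ≠ 0 := hbs.ne'
  set ρret : ℝ := 1 / (32 * bs ^ 2 * (C_E + 1)) with hρret_def
  have hρret : 0 < ρret := by positivity
  unfold PeriodicBECAt
  refine ⟨min (min (min ρ₁ ρc) (min ρd ρr)) ρret,
    lt_min (lt_min (lt_min hρ₁ hρc) (lt_min hρd hρr)) hρret, fun ρ hρ hρlt => ?_⟩
  have hρ_1 : ρ < ρ₁ :=
    hρlt.trans_le ((min_le_left _ _).trans ((min_le_left _ _).trans (min_le_left _ _)))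
  have hρ_c : ρ < ρc :=
    hρlt.trans_le ((min_le_left _ _).trans ((min_le_left _ _).trans (min_le_right _ _)))
  have hρ_d : ρ < ρd :=
    hρlt.trans_le ((min_le_left _ _).trans ((min_le_right _ _).trans (min_le_left _ _)))
  have hρ_r : ρ < ρr :=
    hρlt.trans_le ((min_le_left _ _).trans ((min_le_right _ _).trans (min_le_right _ _)))
  have hρ_ret : ρ < ρret := hρlt.trans_le (min_le_right _ _)
  -- the level reached for real non-negative near-minimisers
  set c₁ : ℝ := 1 / (4 * 𝕄) with hc₁_def
  have hc₁ : 0 < c₁ := by positivity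
  refine ⟨c₁ / 4, by positivity, ?_⟩
  -- eventually in N
  have hevL : ∀ᶠ N : ℕ in atTop, 2 * bs ≤ sideLength ρ N :=
    (tendsto_sideLength_atTop hρ).eventually_ge_atTop (2 * bs)
  have hevN : ∀ᶠ N : ℕ in atTop, 32 * bs ^ 2 ≤ (N : ℝ) :=
    tendsto_natCast_atTop_atTop.eventually_ge_atTop (32 * bs ^ 2)
  filter_upwards [eventually_ge_atTop 2, hevL, hevN, hE ρ hρ hρ_1, htr ρ hρ hρ_r c₁ hc₁]
    with N hN2 hLN hN32 hEN htrN
  -- write N = N' + 2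
  obtain ⟨N', rfl⟩ : ∃ N', N = N' + 2 := ⟨N - 2, by omega⟩
  have hNpos : 0 < N' + 2 := by omega
  set L : ℝ := sideLength ρ (N' + 2) with hL_def
  have hL : 0 < L := sideLength_pos_of_pos hρ hNpos
  -- number of cells per side and the cell size b = L/M ∈ [bs, 2bs]
  set M : ℕ := ⌊L / bs⌋₊ with hM_def
  have hLbs : (2 : ℝ) ≤ L / bs := by
    rw [le_div_iff₀ hbs]; exact hLN
  have hM2 : 2 ≤ M := Nat.le_floor (by exact_mod_cast hLbs)
  have hM1 : 1 ≤ M := le_trans (by norm_num) hM2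
  have hMpos : (0 : ℝ) < M := by exact_mod_cast (lt_of_lt_of_le (by norm_num) hM2 : 0 < M)
  have hM2r : (2 : ℝ) ≤ M := by exact_mod_cast hM2
  have hMle : (M : ℝ) ≤ L / bs := Nat.floor_le (by positivity)
  have hMlt : L / bs < (M : ℝ) + 1 := Nat.lt_floor_add_one _
  have hb_lo : bs ≤ L / M := by
    rw [le_div_iff₀ hMpos]
    calc bs * M ≤ bs * (L / bs) := mul_le_mul_of_nonneg_left hMle hbs.le
      _ = L := by rw [mul_comm]; exact div_mul_cancel₀ L hbs0
  have hb_hi : L / M ≤ 2 * bs := by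
    rw [div_le_iff₀ hMpos]
    have h1 : L < (↑M + 1) * bs := by rwa [div_lt_iff₀ hbs] at hMlt
    nlinarith only [h1, mul_nonneg hbs.le (sub_nonneg.2 hM2r), hbs.le]
  have hb0 : b₀ ≤ L / M := (le_max_left _ _).trans hb_lo
  have hb1' : b₁ ≤ L / M := (le_max_right _ _).trans hb_lo
  have hbpos : 0 < L / M := hbs.trans_le hb_lo
  -- density hypotheses: N' + 2 = ρ L³
  have hNρ : ((N' : ℝ) + 2) = ρ * L ^ 3 := by
    have h := natCast_eq_mul_sideLength_pow_three hρ hNpos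
    push_cast at h
    exact h
  have hL3 : (0 : ℝ) ≤ L ^ 3 := by positivity
  have hdens_c : ((N' : ℝ) + 2) ≤ ρc * L ^ 3 := by
    rw [hNρ]; exact mul_le_mul_of_nonneg_right hρ_c.le hL3
  have hdens_d : ((N' : ℝ) + 2) ≤ ρd * L ^ 3 := by
    rw [hNρ]; exact mul_le_mul_of_nonneg_right hρ_d.le hL3
  -- slacks of the two thermodynamic stubs at this (N, L, M)
  obtain ⟨δ₄, hδ₄, hcohN⟩ := hcoh L M hL hM2 hb0 N' hdens_c
  obtain ⟨δ₅, hδ₅, hdelN⟩ := hdel L M hL hM2 hb1' N' hdens_d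
  set δ₁ : ℝ≥0∞ := min (min δ₄ δ₅) 1 with hδ₁_def
  have hδ₁ : 0 < δ₁ := lt_min (lt_min hδ₄ hδ₅) one_pos
  have hδ₁4 : δ₁ ≤ δ₄ := (min_le_left _ _).trans (min_le_left _ _)
  have hδ₁5 : δ₁ ≤ δ₅ := (min_le_left _ _).trans (min_le_right _ _)
  have hδ₁1 : δ₁ ≤ 1 := min_le_right _ _
  -- the transfer: it suffices to treat real non-negative δ₁-near-minimisers
  refine htrN δ₁ hδ₁ fun Ψ hΨpos hΨE => ?_
  have hE4 : periodicEnergy v Ψ ≤ periodicGroundStateEnergy v (N' + 2) L + δ₄ :=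
    hΨE.trans (add_le_add le_rfl hδ₁4)
  have hE5 : periodicEnergy v Ψ ≤ periodicGroundStateEnergy v (N' + 2) L + δ₅ :=
    hΨE.trans (add_le_add le_rfl hδ₁5)
  have hreal : ∀ X, (Ψ.ψ X).im = 0 := fun X => (hΨpos X).2
  -- the energy of Ψ is finite and O(ρN)
  have hCρN : 0 ≤ C_E * ρ * ((N' + 2 : ℕ) : ℝ) := by positivity
  have hEbd : periodicEnergy v Ψ ≤ ENNReal.ofReal (C_E * ρ * ((N' + 2 : ℕ) : ℝ)) + 1 :=
    hΨE.trans (add_le_add hEN hδ₁1)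
  have hsumtop : ENNReal.ofReal (C_E * ρ * ((N' + 2 : ℕ) : ℝ)) + 1 ≠ ⊤ :=
    ENNReal.add_ne_top.2 ⟨ENNReal.ofReal_ne_top, ENNReal.one_ne_top⟩
  have hEtop : periodicEnergy v Ψ ≠ ⊤ := ne_top_of_le_ne_top hsumtop hEbd
  have hEreal : (periodicEnergy v Ψ).toReal ≤ C_E * ρ * ((N' : ℝ) + 2) + 1 := by
    have h := ENNReal.toReal_mono hsumtop hEbd
    rw [ENNReal.toReal_add ENNReal.ofReal_ne_top ENNReal.one_ne_top, ENNReal.toReal_ofReal hCρN,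
      ENNReal.toReal_one] at h
    push_cast at h
    linarith
  -- the four inequalities of the line
  have hK := h2 v N' L M hL hM1 Ψ hreal hEtop
  have hS := h3 N' L M hL hM1 Ψ
  have hC := hcohN Ψ hΨpos hE4
  have hD := hdelN Ψ hΨpos hE5
  set b : ℝ := L / M with hb_def
  set IK : ℝ := kernelMass L M Ψ.ψ with hIK_def
  set IF : ℝ := fieldMoment L M Ψ.ψ with hIF_def
  set Ir : ℝ := fieldMass L M Ψ.ψ with hIr_def
  set e : ℝ := (periodicEnergy v Ψ).toReal with he_def
  have he0 : 0 ≤ e := ENNReal.toReal_nonneg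
  have hn : (0 : ℝ) < (N' : ℝ) + 2 := by positivity
  have hN32' : 32 * bs ^ 2 ≤ (N' : ℝ) + 2 := by push_cast at hN32; linarith only [hN32]
  -- retention factor ≥ 1/2
  have hb2 : b ^ 2 ≤ 4 * bs ^ 2 := by
    have h' : 0 ≤ 2 * bs - b := sub_nonneg.2 hb_hi
    nlinarith only [h', hbpos.le, hbs.le]
  have hρC : C_E * ρ * (32 * bs ^ 2) ≤ 1 := by
    have h1 : ρ * (32 * bs ^ 2 * (C_E + 1)) < 1 := by
      rwa [hρret_def, lt_div_iff₀ (by positivity)] at hρ_ret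
    nlinarith only [h1, mul_nonneg hρ.le (sq_nonneg bs)]
  have hret : (1 : ℝ) / 2 ≤ 1 - 2 * b ^ 2 * e / ((N' : ℝ) + 2) := by
    have hnum : 2 * b ^ 2 * e ≤ ((N' : ℝ) + 2) / 2 := by
      have s1 : b ^ 2 * e ≤ 4 * bs ^ 2 * e := mul_le_mul_of_nonneg_right hb2 he0
      have s2 : 4 * bs ^ 2 * e ≤ 4 * bs ^ 2 * (C_E * ρ * ((N' : ℝ) + 2) + 1) :=
        mul_le_mul_of_nonneg_left hEreal (by positivity)
      have s3 : C_E * ρ * (32 * bs ^ 2) * ((N' : ℝ) + 2) ≤ (N' : ℝ) + 2 := by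
        have := mul_le_mul_of_nonneg_right hρC hn.le
        linarith only [this]
      nlinarith only [s1, s2, s3, hN32', he0, hbs.le]
    have hdiv : 2 * b ^ 2 * e / ((N' : ℝ) + 2) ≤ 1 / 2 := by
      rw [div_le_iff₀ hn]; linarith only [hnum]
    linarith only [hdiv]
  -- b⁶/2 ≤ I_K
  have hb6 : 0 < b ^ 6 := by positivity
  have hIK : b ^ 6 / 2 ≤ IK :=
    calc b ^ 6 / 2 = b ^ 6 * (1 / 2) := by ring
      _ ≤ b ^ 6 * (1 - 2 * b ^ 2 * e / ((N' : ℝ) + 2)) := mul_le_mul_of_nonneg_left hret hb6.le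
      _ ≤ IK := hK
  -- I_r ≥ M³ b⁶ / (4𝕄)
  have hM3 : (0 : ℝ) < (M : ℝ) ^ 3 := by positivity
  have hIr : (M : ℝ) ^ 3 * b ^ 6 / (4 * 𝕄) ≤ Ir := by
    have h1 : (M : ℝ) ^ 3 * (b ^ 6 / 2) ≤ (M : ℝ) ^ 3 * IK := mul_le_mul_of_nonneg_left hIK hM3.le
    have h2 : (M : ℝ) ^ 3 * IK ≤ (M : ℝ) ^ 3 * (2 * IF) := mul_le_mul_of_nonneg_left hC hM3.le
    rw [div_le_iff₀ (by positivity)]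
    linarith only [h1, h2, hD]
  -- hence c₁ N ≤ N M⁻³ b⁻⁶ I_r
  have hcoef : 0 ≤ ((N' : ℝ) + 2) * ((M : ℝ) ^ 3)⁻¹ * (b ^ 6)⁻¹ := by positivity
  have hfinal : c₁ * ((N' : ℝ) + 2) ≤ ((N' : ℝ) + 2) * ((M : ℝ) ^ 3)⁻¹ * (b ^ 6)⁻¹ * Ir :=
    calc c₁ * ((N' : ℝ) + 2)
        = ((N' : ℝ) + 2) * ((M : ℝ) ^ 3)⁻¹ * (b ^ 6)⁻¹ * ((M : ℝ) ^ 3 * b ^ 6 / (4 * 𝕄)) := by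
          have hM30 : ((M : ℝ) ^ 3) ≠ 0 := hM3.ne'
          have hb60 : b ^ 6 ≠ 0 := hb6.ne'
          have h𝕄0 : 𝕄 ≠ 0 := h𝕄.ne'
          rw [hc₁_def]
          field_simp
      _ ≤ ((N' : ℝ) + 2) * ((M : ℝ) ^ 3)⁻¹ * (b ^ 6)⁻¹ * Ir := mul_le_mul_of_nonneg_left hIr hcoef
  calc ENNReal.ofReal (c₁ * ((N' + 2 : ℕ) : ℝ)) = ENNReal.ofReal (c₁ * ((N' : ℝ) + 2)) := by
          rw [Nat.cast_add, Nat.cast_ofNat]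
    _ ≤ ENNReal.ofReal (((N' : ℝ) + 2) * ((M : ℝ) ^ 3)⁻¹ * (b ^ 6)⁻¹ * Ir) :=
        ENNReal.ofReal_le_ofReal hfinal
    _ ≤ condensateOccupation (N' + 2) L Ψ.ψ := hS

/-- **The line concludes the crux BY NAME.** The antecedent `KineticLatticeBEC` is not consumed: the lattice
MECHANISM (Lorentz signature + delocalisation of the pair-insertion field) is re-instantiated at the cell scale
`b ≈ 3a` instead (`Disproof.crux_of_periodicBEC` shape; TRIAGE r1-1/2/3: "not costume"). -/
theorem LatticeToPeriodicBridge_of (h1 : Sig.stub_diluteEnergyCeiling) (h2 : Sig.stub_cellNormRetention)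
    (h3 : Sig.stub_cellPairSumRule) (h4 : Sig.stub_integratedPairCoherence)
    (h5 : Sig.stub_cellInsertionDelocalisation) (h6 : Sig.stub_positiveTransfer)
    (hR : BECLiebAntibunching.PeriodicRigidity) (hP : BECCountConvexity.PositivePeriodicNearMinimiser) :
    LatticeToPeriodicBridge :=
  fun _hA v hv => periodicBEC_of h1 h2 h3 h4 h5 h6 hR hP v hv

/-- The crux modulo the six registered stubs and the two fixed-`N` route items taken by name (becomes a closing proof
when they land). -/
theorem latticeToPeriodicBridge_skeleton (hR : BECLiebAntibunching.PeriodicRigidity)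
    (hP : BECCountConvexity.PositivePeriodicNearMinimiser) : LatticeToPeriodicBridge :=
  LatticeToPeriodicBridge_of stub_diluteEnergyCeiling stub_cellNormRetention stub_cellPairSumRule
    stub_integratedPairCoherence stub_cellInsertionDelocalisation stub_positiveTransfer hR hP

/-- The same composition also proves stmt-0826's body outright (`BECPeriodicReduction.PeriodicBEC`), which is
what this line really is (TRIAGE r1-2/r1-3: "a line for stmt-0826 housed under the bridge item"). -/
theorem periodicBEC_skeleton (hR : BECLiebAntibunching.PeriodicRigidity)
    (hP : BECCountConvexity.PositivePeriodicNearMinimiser) : BECPeriodicReduction.PeriodicBEC :=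
  fun v hv => periodicBEC_of stub_diluteEnergyCeiling stub_cellNormRetention stub_cellPairSumRule
    stub_integratedPairCoherence stub_cellInsertionDelocalisation stub_positiveTransfer hR hP v hv

/-! ## Sanity: the trivial fixed-`M` instance of S5's inequality and the flat-kernel instance of S4's

Two finite-dimensional checks that the two open stubs are correctly normalised (they are the `v = 0` /
fixed-volume corners every triager probes first). -/

/-- Pointwise majorant behind "S5 is trivial at fixed `M`": for a non-negative field `r` on a finite index set,
`Σr³/R + ‖r‖⁴/R² ≤ 2‖r‖²` (`Σr³ ≤ R·‖r‖²` termwise and `‖r‖² ≤ R²`). -/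
theorem moment_le_two_mul_mass {ι : Type*} [Fintype ι] (r : ι → ℝ) (hr : ∀ x, 0 ≤ r x) :
    (∑ x, r x ^ 3) / (∑ x, r x) + (∑ x, r x ^ 2) ^ 2 / (∑ x, r x) ^ 2 ≤ 2 * ∑ x, r x ^ 2 := by
  set R : ℝ := ∑ x, r x with hR
  set Q : ℝ := ∑ x, r x ^ 2 with hQ
  have hR0 : 0 ≤ R := Finset.sum_nonneg fun x _ => hr x
  have hQ0 : 0 ≤ Q := Finset.sum_nonneg fun x _ => by positivity
  have hle : ∀ x, r x ≤ R := fun x =>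
    Finset.single_le_sum (f := r) (fun y _ => hr y) (Finset.mem_univ x)
  -- Σ r³ ≤ R Q
  have h3 : ∑ x, r x ^ 3 ≤ R * Q := by
    rw [hQ, Finset.mul_sum]
    refine Finset.sum_le_sum fun x _ => ?_
    have hx := hr x
    calc r x ^ 3 = r x * r x ^ 2 := by ring
      _ ≤ R * r x ^ 2 := mul_le_mul_of_nonneg_right (hle x) (by positivity)
  -- Q ≤ R²
  have h2 : Q ≤ R ^ 2 := by
    rw [hQ, hR, sq, Finset.sum_mul_sum]
    refine Finset.sum_le_sum fun x _ => ?_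
    rw [sq, ← Finset.mul_sum]
    exact mul_le_mul_of_nonneg_left (hle x) (hr x)
  by_cases hRz : R = 0
  · simp only [hRz, div_zero, zero_pow two_ne_zero, add_zero]
    positivity
  have hRpos : 0 < R := lt_of_le_of_ne hR0 (Ne.symm hRz)
  have t1 : (∑ x, r x ^ 3) / R ≤ Q := by
    rw [div_le_iff₀ hRpos]; linarith [h3]
  have t2 : Q ^ 2 / R ^ 2 ≤ Q := by
    rw [div_le_iff₀ (by positivity)]
    nlinarith [h2, hQ0]
  linarith

/-- The flat kernel (`v = 0` exact minimiser: `K = k𝟙𝟙ᵀ`, `r = kn𝟙` on `n` cells) sits at `I_K = I_F/2`: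
`‖K‖_F² = n²k²` while `Σr³/R + ‖r‖⁴/R² = 2n²k²` — the factor-2 slack of S4 at `a = 0` (Disproof §8a LESSON). -/
theorem flatKernel_halfSlack (n : ℕ) (k : ℝ) (hn : 0 < n) (hk : 0 < k) :
    let r : Fin n → ℝ := fun _ => ∑ _y : Fin n, k
    (∑ _x : Fin n, ∑ _y : Fin n, k ^ 2) * 2 =
      (∑ x, r x ^ 3) / (∑ x, r x) + (∑ x, r x ^ 2) ^ 2 / (∑ x, r x) ^ 2 := by
  intro r
  have hn' : (n : ℝ) ≠ 0 := by exact_mod_cast hn.ne'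
  have hk' : k ≠ 0 := hk.ne'
  simp only [r, Finset.sum_const, Finset.card_univ, Fintype.card_fin, nsmul_eq_mul]
  field_simp
  ring

end Summit.AtomisticToContinuum.BoseEinsteinCondensation.Cruxes.LatticeToPeriodicBridge.CoarseCellLorentzian

end
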